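import Mathlib
import Summits.PneNP.PneNP.Theses.OneSlice
import Summits.PneNP.PneNP.Theorems.ConstantBand.Negative.LoadBearing
import Summits.PneNP.PneNP.Theorems.SingleThreshold.Negative.LoadBearing

/-!
# Birth skeleton — crux `MonotoneContinuation` (stmt-PneNP-18471, route PneNP/OneSlice), line `sample-then-monotonize`

Two registered stubs and the kernel-checked composition `MonotoneContinuation_of`:

* `stub_sampleTransport` (M/L; derandomized sampling): the canonical slice-`j` transport `ĝ_C` of a small
  `{∧₂,∨₂}`-circuit `C` is, whenever it is `ε`-close in `L¹(G(n,p_c))` to SOME Boolean function, `η`-close to a small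
  GENERAL (`B₂`) circuit `D` (sample `t = O(N/η²)` comparable slice-`j` vectors with random permutations as auxiliary
  inputs, take the majority of `C` on them, fix the randomness by Adleman's argument; size `poly(N)·|C|`).
* `stub_monotonizeStable` (the content; "syntactic = semantic monotonicity in the average case at the critical
  threshold", Rossman ECCC TR16-206 p.20): a small GENERAL circuit that is `ε`-close in `L¹(G(n,p_c))` to SOME monotone
  Boolean function is `η`-close to a small MONOTONE circuit.
* `MonotoneContinuation_of : stub_sampleTransport → stub_monotonizeStable → MonotoneContinuation` — PROVED below
  (triangle inequalities in `L¹(G(n,p_c))` and the quantifier bookkeeping `ε := min ε₁ (ε₂/2)`).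

Hardest stub: `stub_monotonizeStable`. Neither stub is the crux or the summit reworded: the first is a derandomization
lemma about general circuits, the second drops the slice/transport structure entirely (it is STRONGER than the crux on
its domain and is refuted by any average-case monotone/non-monotone gap at one threshold).
Strategist planner-cstrat-stmt-PneNP-2832-r1-0, 2026-08-17.
-/

set_option linter.dupNamespace false

namespace Summit.PneNP.PneNP.Cruxes.MonotoneContinuation.SampleThenMonotonize

open Literature.Computability.Complexity Finset Filter Classical
open Summit.PneNP.PneNP.Theorems.ConstantBand.Negative (Edge Central)
open Summit.PneNP.PneNP.Theorems.SingleThreshold.Negative (pc)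

noncomputable section

/-- The real indicator of a Boolean function. [folklore] -/
def ind {n : ℕ} (f : (Edge n → Bool) → Bool) (x : Edge n → Bool) : ℝ := if f x = true then 1 else 0

/-- `L¹(G(n,p))` distance of two real functions on the edge cube. [folklore] -/
def l1 (n : ℕ) (p : ℝ) (u v : (Edge n → Bool) → ℝ) : ℝ := ∑ y, gnpWeight n p y * |u y - v y|

/-- The canonical slice-`j` transport of `𝟙[C]`, written as the item writes it (ratio of two counts). [folklore] -/
def gC {n : ℕ} (j : ℕ) (C : Circuit (Edge n)) (y : Edge n → Bool) : ℝ :=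
  ((Finset.univ.filter (fun x : ((⊤ : SimpleGraph (Fin n)).edgeSet) → Bool => (Finset.univ.filter (fun e => x e = true)).card = j ∧ ((∀ e, x e = true → y e = true) ∨ (∀ e, y e = true → x e = true)) ∧ C.eval x = true)).card : ℝ) / ((Finset.univ.filter (fun x : ((⊤ : SimpleGraph (Fin n)).edgeSet) → Bool => (Finset.univ.filter (fun e => x e = true)).card = j ∧ ((∀ e, x e = true → y e = true) ∨ (∀ e, y e = true → x e = true)))).card : ℝ)

theorem l1_comm {n : ℕ} (p : ℝ) (u v : (Edge n → Bool) → ℝ) : l1 n p u v = l1 n p v u := by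
  unfold l1; exact sum_congr rfl fun y _ => by rw [abs_sub_comm]

theorem l1_triangle {n : ℕ} {p : ℝ} (hp0 : 0 ≤ p) (hp1 : p ≤ 1) (u v w : (Edge n → Bool) → ℝ) :
    l1 n p u w ≤ l1 n p u v + l1 n p v w := by
  unfold l1
  rw [← sum_add_distrib]
  refine sum_le_sum fun y _ => ?_
  rw [← mul_add]
  exact mul_le_mul_of_nonneg_left (abs_sub_le _ _ _) (gnpWeight_nonneg hp0 hp1 y)

/-! ## The two obligations (statements) -/

/-- **SampleTransport** — derandomized sampling of the transport by a small GENERAL circuit. [folklore] -/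
def SampleTransport : Prop :=
  ∀ c : ℕ, ∃ c₁ : ℕ, ∀ k : ℕ, 3 ≤ k → ∀ η : ℝ, 0 < η → ∃ ε : ℝ, 0 < ε ∧ ∀ᶠ n : ℕ in atTop, ∀ j : ℕ, Central k n j →
    ∀ C : Circuit (Edge n), C.IsOver monotoneBasis → C.size ≤ n ^ c →
      (∃ G : (Edge n → Bool) → Bool, l1 n (pc n k) (ind G) (gC j C) ≤ ε) →
      ∃ D : Circuit (Edge n), D.IsOver B2 ∧ D.size ≤ n ^ c₁ ∧ l1 n (pc n k) (ind D.eval) (gC j C) ≤ η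

/-- **MonotonizeStable** — average-case syntactic = semantic monotonicity at the critical threshold. [folklore] -/
def MonotonizeStable : Prop :=
  ∀ c₁ : ℕ, ∃ c' : ℕ, ∀ k : ℕ, 3 ≤ k → ∀ η : ℝ, 0 < η → ∃ ε : ℝ, 0 < ε ∧ ∀ᶠ n : ℕ in atTop,
    ∀ D : Circuit (Edge n), D.IsOver B2 → D.size ≤ n ^ c₁ →
      (∃ F : (Edge n → Bool) → Bool, Monotone F ∧ l1 n (pc n k) (ind F) (ind D.eval) ≤ ε) →
      ∃ C' : Circuit (Edge n), C'.IsOver monotoneBasis ∧ C'.size ≤ n ^ c' ∧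
        l1 n (pc n k) (ind C'.eval) (ind D.eval) ≤ η

/-! ## Registered stubs -/

/-- **STUB 1 · sampleTransport** (M/L: sampling + Adleman; general circuits). -/
theorem stub_sampleTransport : SampleTransport := by
  sorry

/-- **STUB 2 · monotonizeStable** (the content; hardest stub). -/
theorem stub_monotonizeStable : MonotonizeStable := by
  sorry

/-! ## Name-keyed aliases (the skeleton audit admits a hypothesis of the composition only if it is NAMED like a declared stub) -/
namespace Registered

/-- Alias keyed by the registered stub name. -/
abbrev stub_sampleTransport : Prop := SampleTransport

/-- Alias keyed by the registered stub name. -/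
abbrev stub_monotonizeStable : Prop := MonotonizeStable

end Registered

/-! ## Read-back of the crux and the composition -/

/-- The crux at fixed parameters, over `l1`/`ind`/`gC`. [folklore] -/
def ContAt (c c' k : ℕ) (η ε : ℝ) : Prop :=
  ∀ᶠ n : ℕ in atTop, ∀ j : ℕ, Central k n j → ∀ C : Circuit (Edge n), C.IsOver monotoneBasis → C.size ≤ n ^ c →
    (∃ F : (Edge n → Bool) → Bool, Monotone F ∧ l1 n (pc n k) (ind F) (gC j C) ≤ ε) →
    ∃ C' : Circuit (Edge n), C'.IsOver monotoneBasis ∧ C'.size ≤ n ^ c' ∧ l1 n (pc n k) (ind C'.eval) (gC j C) ≤ η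

/-- Read-back: the crux is `∀ c ∃ c' ∀ k ≥ 3 ∀ η > 0 ∃ ε > 0, ContAt c c' k η ε` (definitional). [folklore] -/
theorem monotoneContinuation_iff :
    Summit.PneNP.PneNP.Theses.OneSlice.MonotoneContinuation ↔
      ∀ c : ℕ, ∃ c' : ℕ, ∀ k : ℕ, 3 ≤ k → ∀ η : ℝ, 0 < η → ∃ ε : ℝ, 0 < ε ∧ ContAt c c' k η ε :=
  Iff.rfl

/-- `0 < p_c ≤ 1` eventually. [folklore] -/
theorem eventually_pc_mem {k : ℕ} (hk : 3 ≤ k) : ∀ᶠ n : ℕ in atTop, 0 < pc n k ∧ pc n k ≤ 1 := by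
  have hp := (Summit.PneNP.PneNP.Theorems.SingleThreshold.Negative.tendsto_pc (show 2 ≤ k by omega)).eventually
    (eventually_le_nhds (show (0 : ℝ) < 1 by norm_num))
  filter_upwards [hp, eventually_ge_atTop 1] with n hn h1
  exact ⟨Real.rpow_pos_of_pos (by exact_mod_cast h1) _, hn⟩

/-- **COMPOSITION.** `stub_sampleTransport → stub_monotonizeStable → MonotoneContinuation`, concluded BY NAME. -/
theorem MonotoneContinuation_of (h₁ : Registered.stub_sampleTransport) (h₂ : Registered.stub_monotonizeStable) :
    Summit.PneNP.PneNP.Theses.OneSlice.MonotoneContinuation := by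
  rw [monotoneContinuation_iff]
  intro c
  obtain ⟨c₁, hc₁⟩ := h₁ c
  obtain ⟨c', hc'⟩ := h₂ c₁
  refine ⟨c', fun k hk η hη => ?_⟩
  obtain ⟨ε₂, hε₂, hev₂⟩ := hc' k hk (η / 2) (by positivity)
  obtain ⟨ε₁, hε₁, hev₁⟩ := hc₁ k hk (min (η / 2) (ε₂ / 2)) (lt_min (by positivity) (by positivity))
  refine ⟨min ε₁ (ε₂ / 2), lt_min hε₁ (by positivity), ?_⟩
  unfold ContAt
  filter_upwards [hev₁, hev₂, eventually_pc_mem hk] with n hn₁ hn₂ hp j hj C hC hsize hF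
  obtain ⟨F, hFmono, hF⟩ := hF
  have hε : l1 n (pc n k) (ind F) (gC j C) ≤ ε₁ := hF.trans (min_le_left _ _)
  obtain ⟨D, hD, hDsize, hDdist⟩ := hn₁ j hj C hC hsize ⟨F, hε⟩
  have hFD : l1 n (pc n k) (ind F) (ind D.eval) ≤ ε₂ := by
    calc l1 n (pc n k) (ind F) (ind D.eval) ≤ l1 n (pc n k) (ind F) (gC j C) + l1 n (pc n k) (gC j C) (ind D.eval) :=
          l1_triangle hp.1.le hp.2 _ _ _
      _ ≤ min ε₁ (ε₂ / 2) + min (η / 2) (ε₂ / 2) := add_le_add hF (by rw [l1_comm]; exact hDdist)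
      _ ≤ ε₂ / 2 + ε₂ / 2 := add_le_add (min_le_right _ _) (min_le_right _ _)
      _ = ε₂ := by ring
  obtain ⟨C', hC', hC'size, hC'dist⟩ := hn₂ D hD hDsize ⟨F, hFmono, hFD⟩
  refine ⟨C', hC', hC'size, ?_⟩
  calc l1 n (pc n k) (ind C'.eval) (gC j C) ≤ l1 n (pc n k) (ind C'.eval) (ind D.eval) + l1 n (pc n k) (ind D.eval) (gC j C) :=
        l1_triangle hp.1.le hp.2 _ _ _
    _ ≤ η / 2 + min (η / 2) (ε₂ / 2) := add_le_add hC'dist hDdist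
    _ ≤ η / 2 + η / 2 := add_le_add le_rfl (min_le_left _ _)
    _ = η := by ring

/-- Wiring check — the assembled skeleton. -/
example : Summit.PneNP.PneNP.Theses.OneSlice.MonotoneContinuation :=
  MonotoneContinuation_of stub_sampleTransport stub_monotonizeStable

end

end Summit.PneNP.PneNP.Cruxes.MonotoneContinuation.SampleThenMonotonize
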